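import Summits.AtomisticToContinuum.HydrodynamicLimit.Theorems.CollisionIsometryCLTCollisionalTransferLocalityBlockFields
import HarnessLib

/-!
# [CL-asm] The constant-profile mesoscopic LLN, glued from its density part and its velocity part
(line `hemisphere-affine-slaving`, crux `CollisionalTransferLocality`, stmt-AtomisticToContinuum-9518)

Helper file (`--supports stmt-AtomisticToContinuum-9518`; registered stub `stub_constLLN_of_parts`).
At fixed `(σ, θ, Φ, φ)` with continuous kernels `φ_N`, write `G_N = localGibbsLaw σ 1 0 θ N (Φ N)` for the
homogeneous local Gibbs law and `ρ̄, m̄, Ē` for the block density, momentum and kinetic-energy fields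
(`rhoB, mB, EB`).  If
* `G_N{δ < ∫ₓ (ρ̄ − 1)²} → 0` for every `δ > 0` (density LLN), and
* `G_N{δ < ∫ₓ ‖m̄‖² + (Ē − (3θ/2) ρ̄)²} → 0` for every `δ > 0` (velocity LLN),
then `G_N{δ < ∫ₓ (ρ̄ − 1)² + ‖m̄‖² + (Ē − 3θ/2)²} → 0` for every `δ > 0` (the route item's `L²` form).

Proof: pathwise, for every `z, x`,
`(Ē − 3θ/2)² = ((Ē − (3θ/2)ρ̄) + (3θ/2)(ρ̄ − 1))² ≤ 2 (Ē − (3θ/2)ρ̄)² + (9θ²/2) (ρ̄ − 1)²`, so the integrand is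
`≤ (1 + 9θ²/2)(ρ̄ − 1)² + 2 [‖m̄‖² + (Ē − (3θ/2)ρ̄)²]`; all three functions of `x` are continuous on the compact
torus (finite sums of continuous functions), hence integrable, and `integral_mono` gives the integrated
domination; so `{δ < ∫ f} ⊆ {δ/(2K) < ∫ (ρ̄ − 1)²} ∪ {δ/4 < ∫ (‖m̄‖² + …)}` with `K = 1 + 9θ²/2`, and the union
bound plus the two hypotheses (at levels `δ/(2K)` and `δ/4`) squeeze the probabilities to `0`.  Only
monotonicity and subadditivity of the outer measure are used (no measurability of the events).
Sources: folklore (Chebyshev-type union bound); H. Spohn, *Large Scale Dynamics of Interacting Particles*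
(1991), Part I §2.3 for the context (local equilibrium LLN of the hard-sphere gas).
-/

namespace Summit.AtomisticToContinuum.HydrodynamicLimit.Theorems.HemisphereAffineSlaving

open scoped BigOperators Topology Classical ENNReal
open Filter Set Function MeasureTheory

noncomputable section

open Literature.MathematicalPhysics.KineticTheory (T3 V3)

namespace ConstLLNOfParts

variable {N : ℕ} {φ : ℕ → T3 → ℝ}

/-- For a continuous kernel and a fixed configuration, `x ↦ (ρ̄(z, x) − 1)²` is continuous. [folklore] -/
theorem continuous_densityDev (hφc : Continuous (φ N)) (z : Cfg N) :
    Continuous fun x => (rhoB φ N z x - 1) ^ 2 := by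
  simp only [rhoB_eq]
  fun_prop

/-- For a continuous kernel and a fixed configuration, `x ↦ ‖m̄‖² + (Ē − (3θ/2) ρ̄)²` is continuous.
[folklore] -/
theorem continuous_velocityDev (θ : ℝ) (hφc : Continuous (φ N)) (z : Cfg N) :
    Continuous fun x => ‖mB φ N z x‖ ^ 2 + (EB φ N z x - 3 / 2 * θ * rhoB φ N z x) ^ 2 := by
  simp only [rhoB_eq, mB_eq, EB_eq]
  fun_prop

/-- For a continuous kernel and a fixed configuration, `x ↦ (ρ̄ − 1)² + ‖m̄‖² + (Ē − 3θ/2)²` is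
continuous. [folklore] -/
theorem continuous_totalDev (θ : ℝ) (hφc : Continuous (φ N)) (z : Cfg N) :
    Continuous fun x =>
      (rhoB φ N z x - 1) ^ 2 + ‖mB φ N z x‖ ^ 2 + (EB φ N z x - 3 / 2 * θ) ^ 2 := by
  simp only [rhoB_eq, mB_eq, EB_eq]
  fun_prop

/-- Pathwise domination: `(ρ̄ − 1)² + ‖m̄‖² + (Ē − 3θ/2)² ≤ (1 + 9θ²/2)(ρ̄ − 1)² + 2[‖m̄‖² + (Ē − (3θ/2)ρ̄)²]`
(`(a + b)² ≤ 2a² + 2b²` with `a = Ē − (3θ/2)ρ̄`, `b = (3θ/2)(ρ̄ − 1)`). [folklore] -/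
theorem totalDev_le (θ : ℝ) (z : Cfg N) (x : T3) :
    (rhoB φ N z x - 1) ^ 2 + ‖mB φ N z x‖ ^ 2 + (EB φ N z x - 3 / 2 * θ) ^ 2 ≤
      (1 + 9 * θ ^ 2 / 2) * (rhoB φ N z x - 1) ^ 2 +
        2 * (‖mB φ N z x‖ ^ 2 + (EB φ N z x - 3 / 2 * θ * rhoB φ N z x) ^ 2) := by
  nlinarith [sq_nonneg (EB φ N z x - 3 / 2 * θ * rhoB φ N z x - 3 / 2 * θ * (rhoB φ N z x - 1)),
    sq_nonneg ‖mB φ N z x‖]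

/-- Integrated domination:
`∫ₓ (ρ̄ − 1)² + ‖m̄‖² + (Ē − 3θ/2)² ≤ (1 + 9θ²/2) ∫ₓ (ρ̄ − 1)² + 2 ∫ₓ [‖m̄‖² + (Ē − (3θ/2)ρ̄)²]`
(all integrands are continuous on the compact torus, hence integrable). [folklore] -/
theorem integral_totalDev_le (θ : ℝ) (hφc : Continuous (φ N)) (z : Cfg N) :
    ∫ x, ((rhoB φ N z x - 1) ^ 2 + ‖mB φ N z x‖ ^ 2 + (EB φ N z x - 3 / 2 * θ) ^ 2) ≤
      (1 + 9 * θ ^ 2 / 2) * (∫ x, (rhoB φ N z x - 1) ^ 2) +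
        2 * ∫ x, (‖mB φ N z x‖ ^ 2 + (EB φ N z x - 3 / 2 * θ * rhoB φ N z x) ^ 2) := by
  have hI1 := (continuous_densityDev hφc z).integrable_unitAddTorus
  have hI2 := (continuous_velocityDev θ hφc z).integrable_unitAddTorus
  rw [← integral_const_mul, ← integral_const_mul,
    ← integral_add (hI1.const_mul _) (hI2.const_mul _)]
  exact integral_mono (continuous_totalDev θ hφc z).integrable_unitAddTorus
    ((hI1.const_mul _).add (hI2.const_mul _)) fun x => totalDev_le θ z x

end ConstLLNOfParts

open ConstLLNOfParts in
/-- **Registered stub [CL-asm] `stub_constLLN_of_parts`** (line `hemisphere-affine-slaving`, crux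
stmt-AtomisticToContinuum-9518; glue of the unconditional equilibrium rung). At fixed `(σ, θ, Φ, φ)` with
continuous kernels: the density LLN `G_N{δ < ∫ₓ (ρ̄ − 1)²} → 0` and the velocity LLN
`G_N{δ < ∫ₓ ‖m̄‖² + (Ē − (3θ/2)ρ̄)²} → 0` (both for all `δ > 0`) give the route item's form
`G_N{δ < ∫ₓ (ρ̄ − 1)² + ‖m̄‖² + (Ē − 3θ/2)²} → 0`.  Pathwise
`(Ē − 3θ/2)² ≤ 2(Ē − (3θ/2)ρ̄)² + (9θ²/2)(ρ̄ − 1)²`, so the integrand is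
`≤ (1 + 9θ²/2)(ρ̄ − 1)² + 2[‖m̄‖² + (Ē − (3θ/2)ρ̄)²]` (`ConstLLNOfParts.integral_totalDev_le`, all fields
continuous in `x` on the compact torus, hence integrable); union bound at levels `δ/2`, i.e. the two
hypotheses at `δ/(2(1 + 9θ²/2))` and `δ/4`, and a squeeze. [folklore] -/
theorem stub_constLLN_of_parts : ∀ (σ θ : ℝ) (Φ : Flows σ) (φ : ℕ → T3 → ℝ), (∀ N, Continuous (φ N)) → (∀ δ : ℝ, 0 < δ → Tendsto (fun N : ℕ => Literature.MathematicalPhysics.KineticTheory.localGibbsLaw σ (fun _ => 1) (fun _ => 0) (fun _ => θ) N (Φ N) {z | δ < ∫ x, (rhoB φ N z x - 1) ^ 2}) atTop (𝓝 0)) → (∀ δ : ℝ, 0 < δ → Tendsto (fun N : ℕ => Literature.MathematicalPhysics.KineticTheory.localGibbsLaw σ (fun _ => 1) (fun _ => 0) (fun _ => θ) N (Φ N) {z | δ < ∫ x, (‖mB φ N z x‖ ^ 2 + (EB φ N z x - 3 / 2 * θ * rhoB φ N z x) ^ 2)}) atTop (𝓝 0)) → ∀ δ : ℝ, 0 < δ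 → Tendsto (fun N : ℕ => Literature.MathematicalPhysics.KineticTheory.localGibbsLaw σ (fun _ => 1) (fun _ => 0) (fun _ => θ) N (Φ N) {z | δ < ∫ x, ((rhoB φ N z x - 1) ^ 2 + ‖mB φ N z x‖ ^ 2 + (EB φ N z x - 3 / 2 * θ) ^ 2)}) atTop (𝓝 0) := by
  intro σ θ Φ φ hφc hρ hv δ hδ
  have hK : 0 < 1 + 9 * θ ^ 2 / 2 := by positivity
  have hδ1 : 0 < δ / (2 * (1 + 9 * θ ^ 2 / 2)) := by positivity
  have hδ2 : 0 < δ / 4 := by positivity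
  have hlim := (hρ _ hδ1).add (hv _ hδ2)
  rw [add_zero] at hlim
  refine tendsto_of_tendsto_of_tendsto_of_le_of_le tendsto_const_nhds hlim (fun _ => zero_le)
    fun N => ?_
  refine (measure_mono fun z hz => ?_).trans (measure_union_le _ _)
  rw [mem_setOf_eq] at hz
  by_contra h
  simp only [mem_union, mem_setOf_eq, not_or, not_lt] at h
  have hle := integral_totalDev_le θ (hφc N) z
  have h1 : (1 + 9 * θ ^ 2 / 2) * ∫ x, (rhoB φ N z x - 1) ^ 2 ≤ δ / 2 :=
    calc (1 + 9 * θ ^ 2 / 2) * ∫ x, (rhoB φ N z x - 1) ^ 2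
        ≤ (1 + 9 * θ ^ 2 / 2) * (δ / (2 * (1 + 9 * θ ^ 2 / 2))) :=
          mul_le_mul_of_nonneg_left h.1 hK.le
      _ = δ / 2 := by
          field_simp
  linarith [h.2]

end

end Summit.AtomisticToContinuum.HydrodynamicLimit.Theorems.HemisphereAffineSlaving
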